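import Literature.NumberTheory.LFunctions.PolynomialRootMoebiusEulerProduct
import Literature.NumberTheory.Sieve.BatemanHornMertensProduct
import HarnessLib

/-!
# The Bateman–Horn constant of a SYSTEM as the Abelian limit of its Euler product

Topic `Literature/NumberTheory/LFunctions` (the `k`-polynomial version of
`PolynomialRootMoebiusEulerProduct.lean`, whose one-polynomial Abelian limits it sums).
Everything here is PROVED.

Let `f : ι → ℤ[X]` be a Bateman–Horn system of `k = #ι` polynomials (`IsBatemanHornSystem f`),
`ω_f(p) = #{r mod p : p ∣ ∏ᵢ fᵢ(r)}` (`polyRootCountMod f p`) and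
`C(f) = lim_x ∏_{p ≤ x} (1 − 1/p)^{-k}(1 − ω_f(p)/p)` its Bateman–Horn constant (`batemanHornConst f`,
an ORDERED, conditionally convergent product; `IsBatemanHornSystem.hasBatemanHornConst_holds`).  With
the Euler factor `e_p(s) = (1 − p^{-s})^{-k}(1 − ω_f(p)p^{-s})`:

* `tendsto_tsum_log_eulerFactorSys` — `Σ_p log e_p(s) → log C(f)` as `s → 1⁺`;
* `tendsto_moebiusRootCountSys_mul_zetaReal_pow` —
  **`(Σ_n μ(n)ω_f(n) n^{-s})·(Σ_n n^{-s})^k → C(f)`** as `s → 1⁺` (real `s`): the ordered product at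
  `s = 1` is the Abelian limit `lim_{s→1⁺} ζ(s)^k ∏_p (1 − ω_f(p)p^{-s})` of the absolutely convergent
  Euler products (`ω_f(n) = polyRootCountMod f n` is multiplicative in `n`: it is `ρ_F` for
  `F = ∏ᵢ fᵢ`, `polyRootCountMod_prod_single`).

Proof: as in the one-polynomial file — `log e_p(s) = (k − ω_f(p))p^{-s} + u_p(s)` with
`|u_p(s)| ≤ (2k + 2D²)p^{-2} + 𝟙[p ≤ 2D](log p + 1)`, `D = Σ deg fᵢ`, uniformly in `s ≥ 1` (Tannery);
the Abelian limit of `Σ_p (k − ω_f(p))p^{-s}` exists because `ω_f(p) = Σᵢ ρ_{fᵢ}(p)` for `p > P₀`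
(`IsBatemanHornSystem.exists_polyRootCountMod_eq_sum`, Bateman–Horn p. 364) and each
`Σ_p (1 − ρ_{fᵢ}(p))p^{-s}` has one (`exists_tendsto_tsum_primes_one_sub_rootCount`); the tree's
Tauberian theorem `PrimeSum.tendsto_sum_primesLE_div` matches it with the ordered sum, and the
ordered `Σ_{p ≤ x} log e_p(1)` is `log` of the Bateman–Horn partial product.

## References

* P. T. Bateman, R. A. Horn, Math. Comp. 16 (1962), 363–367, §2 eq. (2) and p. 364.
  [cite: BatemanHornMathComp1962, §2 eq. (2)]
* H. Davenport, A. Schinzel, Illinois J. Math. 10 (1966), 181–185. [cite: DavenportSchinzel1966]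
* H. L. Montgomery, R. C. Vaughan, *Multiplicative Number Theory I*, Thm. 5.11.
  [cite: MontgomeryVaughan2007, Thm. 5.11]
-/

noncomputable section

open Filter Finset Nat ArithmeticFunction Polynomial Complex
open scoped Topology BigOperators ArithmeticFunction.Moebius

namespace Literature.NumberTheory.LFunctions

open Literature.NumberTheory.Sieve

/-! Local notation (no new definitions): the one-polynomial arithmetic function `μρ[g]` of the
upstream files, the Euler factor of the system, the majorant of its second-order remainder, and
the real zeta series. -/

/-- `a = μρ_g` as a complex arithmetic function (same local notation as upstream). -/
local notation "μρ[" g "]" => toArithmeticFunction (fun n : ℕ =>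
  ((ArithmeticFunction.moebius n : ℤ) : ℂ) * ((Literature.NumberTheory.Sieve.polyRootCountMod ![g] n : ℕ) : ℂ))

/-- The Euler factor `e_p(s) = (1 − p^{-s})^{-k}(1 − ω_f(p) p^{-s})` (real `s`; `k` the number of
polynomials, passed explicitly). -/
local notation "eSys(" k ", " f ", " s ", " p ")" =>
  (((1 - (p : ℝ) ^ (-(s : ℝ)))⁻¹) ^ (k : ℕ) *
    (1 - (polyRootCountMod f p : ℝ) * (p : ℝ) ^ (-(s : ℝ))))

/-- The uniform majorant `(2k + 2D²) p^{-2} + 𝟙[p ≤ 2D](log p + 1)` of the second-order remainder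
`log e_p(s) − (k − ω_f(p)) p^{-s}`, `s ≥ 1`. -/
local notation "bndSys(" k ", " D ", " p ")" =>
  ((2 * ((k : ℕ) : ℝ) + 2 * ((D : ℕ) : ℝ) ^ 2) * (p : ℝ) ^ (-2 : ℝ) +
    (ite ((p : ℕ) ≤ 2 * (D : ℕ)) (Real.log (p : ℝ) + 1) 0))

/-- The real zeta series `Σ_n n^{-s}`. -/
local notation "ζℝ(" s ")" => (∑' n : ℕ, (n : ℝ) ^ (-(s : ℝ)))

section System

variable {ι : Type*} [Fintype ι] {f : ι → ℤ[X]} (hf : IsBatemanHornSystem f)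

omit hf in
/-- `ω_f(n) = ρ_F(n)` for `F = ∏ᵢ fᵢ`: the system's count is the one-polynomial count of the product.
[folklore] -/
theorem polyRootCountMod_prod_single (f : ι → ℤ[X]) (n : ℕ) :
    polyRootCountMod ![∏ i, f i] n = polyRootCountMod f n := by
  rw [polyRootCountMod_single]
  unfold polyRootCountMod
  simp only [Polynomial.eval_prod]

omit hf in
/-- `ω_f` is multiplicative on coprime arguments (CRT, through `ρ_F`). [folklore] -/
theorem polyRootCountModSys_mul_of_coprime (f : ι → ℤ[X]) {m n : ℕ} (hmn : m.Coprime n) :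
    polyRootCountMod f (m * n) = polyRootCountMod f m * polyRootCountMod f n := by
  rw [← polyRootCountMod_prod_single, ← polyRootCountMod_prod_single f m,
    ← polyRootCountMod_prod_single f n]
  exact polyRootCountMod_mul_of_coprime _ hmn

omit hf in
/-- `ω_f(p) ≤ Σᵢ ρ_{fᵢ}(p)` at a prime `p` (a root of the product is a root of a factor). [folklore] -/
theorem polyRootCountModSys_le_sum_single (f : ι → ℤ[X]) {p : ℕ} (hp : p.Prime) :
    polyRootCountMod f p ≤ ∑ i, polyRootCountMod ![f i] p := by
  classical
  have hpz : _root_.Prime (p : ℤ) := Nat.prime_iff_prime_int.mp hp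
  simp_rw [polyRootCountMod_single]
  unfold polyRootCountMod
  calc #((range p).filter fun n : ℕ => (p : ℤ) ∣ ∏ i, (f i).eval (n : ℤ))
      ≤ #((Finset.univ : Finset ι).biUnion fun i =>
          (range p).filter fun n : ℕ => (p : ℤ) ∣ (f i).eval (n : ℤ)) := by
        refine card_le_card fun n hn => ?_
        rw [mem_filter] at hn
        obtain ⟨i, -, hi⟩ := (hpz.dvd_finsetProd_iff _).mp hn.2
        exact mem_biUnion.mpr ⟨i, mem_univ i, mem_filter.mpr ⟨hn.1, hi⟩⟩
    _ ≤ ∑ i, #((range p).filter fun n : ℕ => (p : ℤ) ∣ (f i).eval (n : ℤ)) := card_biUnion_le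

include hf

/-- `ω_f(p) ≤ D = Σᵢ deg fᵢ` at every prime. [folklore] -/
theorem sys_rootCount_le {p : ℕ} (hp : p.Prime) :
    (polyRootCountMod f p : ℝ) ≤ ((∑ i, (f i).natDegree : ℕ) : ℝ) := by
  have h1 := polyRootCountModSys_le_sum_single f hp
  have h2 : ∑ i, polyRootCountMod ![f i] p ≤ ∑ i, (f i).natDegree :=
    Finset.sum_le_sum fun i _ =>
      polyRootCountMod_prime_le_natDegree_of_irreducible (hf.irreducible i) (hf.natDegree_pos i) hp
  exact_mod_cast h1.trans h2

/-- `ω_f(p) ≤ p − 1` at every prime (no fixed prime divisor). [folklore] -/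
theorem sys_rootCount_le_sub_one {p : ℕ} (hp : p.Prime) :
    (polyRootCountMod f p : ℝ) ≤ (p : ℝ) - 1 := by
  have h : polyRootCountMod f p < p := hf.hasNoFixedPrimeDivisor p hp
  have h' : polyRootCountMod f p + 1 ≤ p := h
  have := (Nat.cast_le (α := ℝ)).mpr h'
  push_cast at this
  linarith

/-- Positivity of the two factors of `e_p(s)` for `s ≥ 1`. [folklore] -/
theorem eulerFactorSys_parts_pos {p : ℕ} (hp : p.Prime) {s : ℝ} (hs : 1 ≤ s) :
    0 < 1 - (p : ℝ) ^ (-s) ∧ 0 < 1 - (polyRootCountMod f p : ℝ) * (p : ℝ) ^ (-s) := by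
  obtain ⟨hu0, hu1, hu2⟩ := rpow_neg_le_inv hp hs
  have hp2 : (2 : ℝ) ≤ p := by exact_mod_cast hp.two_le
  have hp0 : (0 : ℝ) < p := by linarith
  have hρ := sys_rootCount_le_sub_one hf hp
  have hρ0 : (0 : ℝ) ≤ polyRootCountMod f p := Nat.cast_nonneg _
  refine ⟨by linarith, ?_⟩
  have h1 : (polyRootCountMod f p : ℝ) * (p : ℝ) ^ (-s) ≤ ((p : ℝ) - 1) * (p : ℝ)⁻¹ :=
    mul_le_mul hρ hu1 hu0.le (by linarith)
  have h2 : ((p : ℝ) - 1) * (p : ℝ)⁻¹ < 1 := by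
    rw [mul_inv_lt_iff₀ hp0]
    linarith
  linarith

/-- Positivity of the Euler factor `e_p(s)` for `s ≥ 1`. [folklore] -/
theorem eulerFactorSys_pos {p : ℕ} (hp : p.Prime) {s : ℝ} (hs : 1 ≤ s) :
    0 < eSys(Fintype.card ι, f, s, p) := by
  obtain ⟨h1, h2⟩ := eulerFactorSys_parts_pos hf hp hs
  exact mul_pos (pow_pos (inv_pos.mpr h1) _) h2

/-- `|log e_p(s) − (k − ω_f(p)) p^{-s}| ≤ bndSys(k, D, p)` uniformly in `s ≥ 1`. [folklore] -/
theorem abs_log_eulerFactorSys_sub_le {p : ℕ} (hp : p.Prime) {s : ℝ} (hs : 1 ≤ s) :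
    |Real.log (eSys(Fintype.card ι, f, s, p)) -
        ((Fintype.card ι : ℝ) - (polyRootCountMod f p : ℝ)) * (p : ℝ) ^ (-s)| ≤
      bndSys(Fintype.card ι, ∑ i, (f i).natDegree, p) := by
  obtain ⟨hu0, hu1, hu2⟩ := rpow_neg_le_inv hp hs
  obtain ⟨h1, h2⟩ := eulerFactorSys_parts_pos hf hp hs
  have hp2 : (2 : ℝ) ≤ p := by exact_mod_cast hp.two_le
  have hp0 : (0 : ℝ) < p := by linarith
  set k : ℕ := Fintype.card ι with hk
  set Dn : ℕ := ∑ i, (f i).natDegree with hDn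
  set u : ℝ := (p : ℝ) ^ (-s) with hu
  set ρ : ℝ := (polyRootCountMod f p : ℝ) with hρdef
  set w : ℝ := ρ * u with hw
  set d : ℝ := (Dn : ℝ) with hd
  have hρ0 : 0 ≤ ρ := Nat.cast_nonneg _
  have hw0 : 0 ≤ w := mul_nonneg hρ0 hu0.le
  have hρd : ρ ≤ d := by
    have := sys_rootCount_le hf hp
    rw [hd, hDn]; exact this
  -- the decomposition of the remainder
  have hlog : Real.log (eSys(k, f, s, p)) = -(k : ℝ) * Real.log (1 - u) + Real.log (1 - w) := by
    rw [Real.log_mul (pow_pos (inv_pos.mpr h1) _).ne' h2.ne', Real.log_pow, Real.log_inv]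
    ring
  have e : Real.log (eSys(k, f, s, p)) - ((k : ℝ) - ρ) * u =
      -(k : ℝ) * (Real.log (1 - u) + u) + (Real.log (1 - w) + w) := by
    rw [hlog, hw]; ring
  rw [e]
  have hu_sq : u ^ 2 ≤ (p : ℝ) ^ (-2 : ℝ) := by
    calc u ^ 2 ≤ ((p : ℝ)⁻¹) ^ 2 := pow_le_pow_left₀ hu0.le hu1 2
      _ = (p : ℝ) ^ (-2 : ℝ) := by
        rw [show (-2 : ℝ) = -(2 : ℝ) by norm_num, Real.rpow_neg hp0.le, Real.rpow_two, inv_pow]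
  have b1 : |Real.log (1 - u) + u| ≤ 2 * u ^ 2 := abs_log_one_sub_add_le hu0.le (hu1.trans hu2)
  have hnn : 0 ≤ (p : ℝ) ^ (-2 : ℝ) := Real.rpow_nonneg hp0.le _
  have b2 : |Real.log (1 - w) + w| ≤ 2 * d ^ 2 * (p : ℝ) ^ (-2 : ℝ) +
      (if p ≤ 2 * Dn then Real.log (p : ℝ) + 1 else 0) := by
    by_cases hsmall : p ≤ 2 * Dn
    · rw [if_pos hsmall]
      have hρp : ρ ≤ (p : ℝ) - 1 := sys_rootCount_le_sub_one hf hp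
      have hw1 : w ≤ ((p : ℝ) - 1) * (p : ℝ)⁻¹ := mul_le_mul hρp hu1 hu0.le (by linarith)
      have hwp : (p : ℝ)⁻¹ ≤ 1 - w := by
        have : ((p : ℝ) - 1) * (p : ℝ)⁻¹ = 1 - (p : ℝ)⁻¹ := by field_simp
        linarith
      have hw_le_one : w ≤ 1 := by
        have : (p : ℝ)⁻¹ > 0 := inv_pos.mpr hp0
        linarith
      have hlogw : |Real.log (1 - w)| ≤ Real.log p := by
        rw [abs_of_nonpos (Real.log_nonpos (by linarith) (by linarith))]
        have := Real.log_le_log (inv_pos.mpr hp0) hwp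
        rw [Real.log_inv] at this
        linarith
      calc |Real.log (1 - w) + w| ≤ |Real.log (1 - w)| + |w| := abs_add_le _ _
        _ ≤ Real.log p + 1 := by rw [abs_of_nonneg hw0]; linarith
        _ ≤ 2 * d ^ 2 * (p : ℝ) ^ (-2 : ℝ) + (Real.log (p : ℝ) + 1) := by
          have : 0 ≤ 2 * d ^ 2 * (p : ℝ) ^ (-2 : ℝ) := by positivity
          linarith
    · rw [if_neg hsmall, add_zero]
      have hlt : (2 * Dn : ℝ) < p := by exact_mod_cast (not_le.mp hsmall)
      have hwd : w ≤ d * u := mul_le_mul_of_nonneg_right hρd hu0.le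
      have hw2 : w ≤ 1 / 2 := by
        have hdu : d * u ≤ d * (p : ℝ)⁻¹ := mul_le_mul_of_nonneg_left hu1 (Nat.cast_nonneg _)
        have : d * (p : ℝ)⁻¹ ≤ 1 / 2 := by
          rw [← div_eq_mul_inv, div_le_iff₀ hp0]
          rw [hd]; linarith
        linarith
      calc |Real.log (1 - w) + w| ≤ 2 * w ^ 2 := abs_log_one_sub_add_le hw0 hw2
        _ ≤ 2 * (d * u) ^ 2 := by gcongr
        _ = 2 * d ^ 2 * u ^ 2 := by ring
        _ ≤ 2 * d ^ 2 * (p : ℝ) ^ (-2 : ℝ) := by gcongr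
  calc |-(k : ℝ) * (Real.log (1 - u) + u) + (Real.log (1 - w) + w)|
      ≤ |-(k : ℝ) * (Real.log (1 - u) + u)| + |Real.log (1 - w) + w| := abs_add_le _ _
    _ = (k : ℝ) * |Real.log (1 - u) + u| + |Real.log (1 - w) + w| := by
        rw [abs_mul, abs_neg, Nat.abs_cast]
    _ ≤ (k : ℝ) * (2 * u ^ 2) + (2 * d ^ 2 * (p : ℝ) ^ (-2 : ℝ) +
          (if p ≤ 2 * Dn then Real.log (p : ℝ) + 1 else 0)) := by gcongr
    _ ≤ (k : ℝ) * (2 * (p : ℝ) ^ (-2 : ℝ)) + (2 * d ^ 2 * (p : ℝ) ^ (-2 : ℝ) +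
          (if p ≤ 2 * Dn then Real.log (p : ℝ) + 1 else 0)) := by gcongr
    _ = bndSys(k, Dn, p) := by rw [hd]; ring

/-- Continuity at `s = 1` of the remainder `log e_p(s) − (k − ω_f(p)) p^{-s}`. [folklore] -/
theorem tendsto_log_eulerFactorSys_sub {p : ℕ} (hp : p.Prime) :
    Tendsto (fun s : ℝ => Real.log (eSys(Fintype.card ι, f, s, p)) -
        ((Fintype.card ι : ℝ) - (polyRootCountMod f p : ℝ)) * (p : ℝ) ^ (-s))
      (𝓝[>] 1) (𝓝 (Real.log (eSys(Fintype.card ι, f, 1, p)) -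
        ((Fintype.card ι : ℝ) - (polyRootCountMod f p : ℝ)) * (p : ℝ) ^ (-(1 : ℝ)))) := by
  obtain ⟨h1, h2⟩ := eulerFactorSys_parts_pos hf hp le_rfl
  have hu := continuousAt_rpow_neg hp 1
  have hc : ContinuousAt (fun s : ℝ => Real.log (eSys(Fintype.card ι, f, s, p)) -
      ((Fintype.card ι : ℝ) - (polyRootCountMod f p : ℝ)) * (p : ℝ) ^ (-s)) 1 := by
    refine ContinuousAt.sub ?_ (hu.const_mul _)
    refine ContinuousAt.log (ContinuousAt.mul ?_ ?_)
      (mul_pos (pow_pos (inv_pos.mpr h1) _) h2).ne'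
    · exact ((continuousAt_const.sub hu).inv₀ h1.ne').pow _
    · exact continuousAt_const.sub (hu.const_mul _)
  exact hc.tendsto.mono_left nhdsWithin_le_nhds

omit hf in
/-- The majorant `bndSys` is summable over the primes. [folklore] -/
theorem summable_bndSys (k D : ℕ) : Summable fun p : Nat.Primes => bndSys(k, D, p) := by
  refine Summable.add (((Nat.Primes.summable_rpow (r := -2)).mpr (by norm_num)).mul_left _) ?_
  refine summable_of_ne_finset_zero (s := ((Finset.range (2 * D + 1)).filter
    Nat.Prime).subtype Nat.Prime) ?_
  intro p hp
  rw [if_neg]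
  intro hle
  exact hp (Finset.mem_subtype.mpr (Finset.mem_filter.mpr
    ⟨Finset.mem_range.mpr (Nat.lt_succ_of_le hle), p.prop⟩))

/-- Summability of the remainders over the primes, `s ≥ 1`. [folklore] -/
theorem summable_logErrSys {s : ℝ} (hs : 1 ≤ s) :
    Summable fun p : Nat.Primes => Real.log (eSys(Fintype.card ι, f, s, p)) -
      ((Fintype.card ι : ℝ) - (polyRootCountMod f p : ℝ)) * (p : ℝ) ^ (-s) := by
  refine Summable.of_norm_bounded (summable_bndSys (Fintype.card ι) (∑ i, (f i).natDegree))
    fun p => ?_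
  rw [Real.norm_eq_abs]
  exact abs_log_eulerFactorSys_sub_le hf p.prop hs

/-- Summability of the main terms `(k − ω_f(p)) p^{-s}` over the primes, `s > 1`. [folklore] -/
theorem summable_mainSys {s : ℝ} (hs : 1 < s) :
    Summable fun p : Nat.Primes =>
      ((Fintype.card ι : ℝ) - (polyRootCountMod f p : ℝ)) * (p : ℝ) ^ (-s) := by
  refine Summable.of_norm_bounded ((Nat.Primes.summable_rpow.mpr (by linarith : -s < -1)).mul_left
    ((Fintype.card ι : ℝ) + ((∑ i, (f i).natDegree : ℕ) : ℝ))) fun p => ?_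
  rw [Real.norm_eq_abs, abs_mul, abs_of_nonneg (Real.rpow_nonneg (Nat.cast_nonneg _) _)]
  refine mul_le_mul_of_nonneg_right ?_ (Real.rpow_nonneg (Nat.cast_nonneg _) _)
  have h1 := sys_rootCount_le hf p.prop
  have h0 : (0 : ℝ) ≤ polyRootCountMod f p := Nat.cast_nonneg _
  have hk : (0 : ℝ) ≤ Fintype.card ι := Nat.cast_nonneg _
  rw [abs_le]; constructor <;> linarith

/-- Summability of `log e_p(s)` over the primes, `s > 1`, and the split of its sum. [folklore] -/
theorem summable_log_eulerFactorSys {s : ℝ} (hs : 1 < s) :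
    Summable (fun p : Nat.Primes => Real.log (eSys(Fintype.card ι, f, s, p))) ∧
      ∑' p : Nat.Primes, Real.log (eSys(Fintype.card ι, f, s, p)) =
        ∑' p : Nat.Primes, ((Fintype.card ι : ℝ) - (polyRootCountMod f p : ℝ)) * (p : ℝ) ^ (-s) +
          ∑' p : Nat.Primes, (Real.log (eSys(Fintype.card ι, f, s, p)) -
            ((Fintype.card ι : ℝ) - (polyRootCountMod f p : ℝ)) * (p : ℝ) ^ (-s)) := by
  have hA := summable_mainSys hf hs
  have hB := summable_logErrSys hf hs.le
  have hsum : Summable (fun p : Nat.Primes => Real.log (eSys(Fintype.card ι, f, s, p))) := by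
    refine (hA.add hB).congr fun p => ?_
    ring
  refine ⟨hsum, ?_⟩
  rw [← hA.tsum_add hB]
  exact tsum_congr fun p => by ring

/-- The Abelian limit of `Σ_p (k − ω_f(p)) p^{-s}` (`s → 1⁺`) exists: `ω_f(p) = Σᵢ ρ_{fᵢ}(p)` beyond
`P₀` (Bateman–Horn p. 364) and each `Σ_p (1 − ρ_{fᵢ}(p))p^{-s}` has an Abelian limit
(`exists_tendsto_tsum_primes_one_sub_rootCount`). [cite: BatemanHornMathComp1962, p. 364] -/
theorem exists_tendsto_tsum_primes_card_sub_rootCountSys :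
    ∃ S : ℝ, Tendsto (fun s : ℝ => ∑' p : Nat.Primes,
      ((Fintype.card ι : ℝ) - (polyRootCountMod f p : ℝ)) * (p : ℝ) ^ (-s)) (𝓝[>] 1) (𝓝 S) := by
  classical
  obtain ⟨P₀, hP₀⟩ := hf.exists_polyRootCountMod_eq_sum
  choose S hS using fun i => exists_tendsto_tsum_primes_one_sub_rootCount
    (BatemanHornMertens.isBatemanHornSystem_single hf i)
  -- the correction at the finitely many primes `p ≤ P₀`
  set δ : Nat.Primes → ℝ := fun p =>
    (∑ i, (polyRootCountMod ![f i] p : ℝ)) - (polyRootCountMod f p : ℝ) with hδ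
  set T : Finset Nat.Primes := ((Finset.range (P₀ + 1)).filter Nat.Prime).subtype Nat.Prime with hT
  have hδ0 : ∀ p : Nat.Primes, p ∉ T → δ p = 0 := by
    intro p hp
    have hlt : P₀ < (p : ℕ) := by
      by_contra hle
      exact hp (Finset.mem_subtype.mpr (Finset.mem_filter.mpr
        ⟨Finset.mem_range.mpr (Nat.lt_succ_of_le (not_lt.mp hle)), p.prop⟩))
    simp only [hδ]
    rw [hP₀ p p.prop hlt]
    push_cast
    ring
  have h2 : Tendsto (fun s : ℝ => ∑ p ∈ T, δ p * (p : ℝ) ^ (-s)) (𝓝[>] 1)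
      (𝓝 (∑ p ∈ T, δ p * (p : ℝ) ^ (-(1 : ℝ)))) := by
    refine (tendsto_finsetSum T fun p _ => ?_).mono_left nhdsWithin_le_nhds
    exact ((continuousAt_rpow_neg p.prop 1).const_mul (δ p)).tendsto
  have h1 : Tendsto (fun s : ℝ => ∑ i, ∑' p : Nat.Primes,
      (1 - (polyRootCountMod ![f i] p : ℝ)) * (p : ℝ) ^ (-s)) (𝓝[>] 1) (𝓝 (∑ i, S i)) :=
    tendsto_finsetSum _ fun i _ => hS i
  refine ⟨∑ i, S i + ∑ p ∈ T, δ p * (p : ℝ) ^ (-(1 : ℝ)), (h1.add h2).congr' ?_⟩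
  filter_upwards [self_mem_nhdsWithin] with s (hs : 1 < s)
  have hSi : ∀ i, Summable fun p : Nat.Primes =>
      (1 - (polyRootCountMod ![f i] p : ℝ)) * (p : ℝ) ^ (-s) :=
    fun i => summable_main (BatemanHornMertens.isBatemanHornSystem_single hf i) hs
  have hS2 : Summable fun p : Nat.Primes => δ p * (p : ℝ) ^ (-s) :=
    summable_of_ne_finset_zero (s := T) fun p hp => by rw [hδ0 p hp, zero_mul]
  have h3 : ∑' p : Nat.Primes, δ p * (p : ℝ) ^ (-s) = ∑ p ∈ T, δ p * (p : ℝ) ^ (-s) :=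
    tsum_eq_sum fun p hp => by rw [hδ0 p hp, zero_mul]
  have h4 : ∑ i, ∑' p : Nat.Primes, (1 - (polyRootCountMod ![f i] p : ℝ)) * (p : ℝ) ^ (-s) =
      ∑' p : Nat.Primes, ∑ i, (1 - (polyRootCountMod ![f i] p : ℝ)) * (p : ℝ) ^ (-s) :=
    (Summable.tsum_finsetSum (fun i _ => hSi i)).symm
  rw [← h3, h4, ← (summable_sum fun i _ => hSi i).tsum_add hS2]
  refine tsum_congr fun p => ?_
  simp only [hδ]
  rw [← Finset.sum_mul, Finset.sum_sub_distrib, Finset.sum_const, Finset.card_univ, nsmul_eq_mul,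
    mul_one]
  ring

/-- The Bateman–Horn partial product of `f` is the ordered product of the `e_p(1)`. [folklore] -/
theorem log_batemanHornPartialSys_eq (x : ℕ) :
    Real.log (batemanHornPartial f x) =
      ∑ p ∈ Nat.primesLE x, Real.log (eSys(Fintype.card ι, f, 1, p)) := by
  unfold batemanHornPartial
  rw [Real.log_prod]
  · refine Finset.sum_congr rfl fun p hp => ?_
    congr 1
    rw [Real.rpow_neg_one, one_div, div_eq_mul_inv]
  · intro p hp
    have hp' : (p : ℕ).Prime := (Nat.mem_primesLE.mp hp).2
    have h := eulerFactorSys_pos hf hp' le_rfl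
    rw [one_div]
    rw [Real.rpow_neg_one, ← div_eq_mul_inv] at h
    exact h.ne'

/-- **`Σ_p log e_p(s) → log C(f)` as `s → 1⁺`** — Tauberian matching of the Abelian limit with the
ordered one, Tannery for the remainders, and `IsBatemanHornSystem.hasBatemanHornConst_holds`.
[cite: BatemanHornMathComp1962, §2 eq. (2)] -/
theorem tendsto_tsum_log_eulerFactorSys :
    Tendsto (fun s : ℝ => ∑' p : Nat.Primes, Real.log (eSys(Fintype.card ι, f, s, p))) (𝓝[>] 1)
      (𝓝 (Real.log (batemanHornConst f))) := by
  obtain ⟨hC, hCpos⟩ := IsBatemanHornSystem.hasBatemanHornConst_holds hf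
  obtain ⟨S, hS⟩ := exists_tendsto_tsum_primes_card_sub_rootCountSys hf
  set err₁ : ℕ → ℝ := fun p => Real.log (eSys(Fintype.card ι, f, 1, p)) -
    ((Fintype.card ι : ℝ) - (polyRootCountMod f p : ℝ)) * (p : ℝ) ^ (-(1 : ℝ)) with herr₁
  have hU : Summable fun p : Nat.Primes => err₁ p := summable_logErrSys hf le_rfl
  set U₁ : ℝ := ∑' p : Nat.Primes, err₁ p with hU₁
  -- (1) Tauberian matching
  have hT : Tendsto (fun x : ℕ => ∑ p ∈ Nat.primesLE x,
      ((Fintype.card ι : ℝ) - (polyRootCountMod f p : ℝ)) / p) atTop (𝓝 S) := by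
    refine PrimeSum.tendsto_sum_primesLE_div
      (a := fun p => (Fintype.card ι : ℝ) - (polyRootCountMod f p : ℝ))
      (B := (Fintype.card ι : ℝ) + ((∑ i, (f i).natDegree : ℕ) : ℝ)) (fun p hp => ?_) hS
    have h1 := sys_rootCount_le hf hp
    have h0 : (0 : ℝ) ≤ polyRootCountMod f p := Nat.cast_nonneg _
    have hk : (0 : ℝ) ≤ Fintype.card ι := Nat.cast_nonneg _
    rw [abs_le]; constructor <;> linarith
  -- (2) the ordered remainder sums converge to `U₁`
  have hE : Tendsto (fun x : ℕ => ∑ p ∈ Nat.primesLE x, err₁ p) atTop (𝓝 U₁) :=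
    (LogEulerProduct.tendsto_sum_primesBelow (F := err₁) hU).comp (tendsto_add_atTop_nat 1)
  -- (3) the ordered log-products converge to `log C`
  have hP : Tendsto (fun x : ℕ => ∑ p ∈ Nat.primesLE x,
      Real.log (eSys(Fintype.card ι, f, 1, p))) atTop (𝓝 (Real.log (batemanHornConst f))) := by
    have h1 : Tendsto (fun x : ℕ => Real.log (batemanHornPartial f x)) atTop
        (𝓝 (Real.log (batemanHornConst f))) :=
      (Real.continuousAt_log hCpos.ne').tendsto.comp hC
    refine h1.congr fun x => ?_
    exact log_batemanHornPartialSys_eq hf x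
  have hsplit : ∀ x : ℕ, ∑ p ∈ Nat.primesLE x, Real.log (eSys(Fintype.card ι, f, 1, p)) =
      ∑ p ∈ Nat.primesLE x, ((Fintype.card ι : ℝ) - (polyRootCountMod f p : ℝ)) / p +
        ∑ p ∈ Nat.primesLE x, err₁ p := by
    intro x
    rw [← Finset.sum_add_distrib]
    refine Finset.sum_congr rfl fun p _ => ?_
    simp only [herr₁, Real.rpow_neg_one, div_eq_mul_inv]
    ring
  have hlogC : Real.log (batemanHornConst f) = S + U₁ :=
    tendsto_nhds_unique hP ((hT.add hE).congr fun x => (hsplit x).symm)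
  -- (4) `s → 1⁺`
  have hTan : Tendsto (fun s : ℝ => ∑' p : Nat.Primes, (Real.log (eSys(Fintype.card ι, f, s, p)) -
      ((Fintype.card ι : ℝ) - (polyRootCountMod f p : ℝ)) * (p : ℝ) ^ (-s))) (𝓝[>] 1) (𝓝 U₁) := by
    refine tendsto_tsum_of_dominated_convergence
      (bound := fun p : Nat.Primes => bndSys(Fintype.card ι, ∑ i, (f i).natDegree, p))
      (summable_bndSys _ _) (fun p => tendsto_log_eulerFactorSys_sub hf p.prop) ?_
    filter_upwards [self_mem_nhdsWithin] with s (hs : 1 < s)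
    intro p
    rw [Real.norm_eq_abs]
    exact abs_log_eulerFactorSys_sub_le hf p.prop hs.le
  rw [hlogC]
  refine (hS.add hTan).congr' ?_
  filter_upwards [self_mem_nhdsWithin] with s (hs : 1 < s)
  exact ((summable_log_eulerFactorSys hf hs).2).symm

/-- `exp Σ_p log e_p(s) → C(f)` as `s → 1⁺`. [folklore] -/
theorem tendsto_exp_tsum_log_eulerFactorSys :
    Tendsto (fun s : ℝ => Real.exp (∑' p : Nat.Primes, Real.log (eSys(Fintype.card ι, f, s, p))))
      (𝓝[>] 1) (𝓝 (batemanHornConst f)) := by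
  obtain ⟨-, hCpos⟩ := IsBatemanHornSystem.hasBatemanHornConst_holds hf
  have h : Tendsto (fun s : ℝ => Real.exp (∑' p : Nat.Primes,
      Real.log (eSys(Fintype.card ι, f, s, p)))) (𝓝[>] 1)
      (𝓝 (Real.exp (Real.log (batemanHornConst f)))) :=
    (Real.continuous_exp.tendsto _).comp (tendsto_tsum_log_eulerFactorSys hf)
  rwa [Real.exp_log hCpos] at h

/-- For `s > 1` the partial Euler products converge to `exp Σ_p log e_p(s)`. [folklore] -/
theorem tendsto_prod_primesBelow_eulerFactorSys {s : ℝ} (hs : 1 < s) :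
    Tendsto (fun N : ℕ => ∏ p ∈ primesBelow N, eSys(Fintype.card ι, f, s, p)) atTop
      (𝓝 (Real.exp (∑' p : Nat.Primes, Real.log (eSys(Fintype.card ι, f, s, p))))) := by
  have hsum := (summable_log_eulerFactorSys hf hs).1
  have h1 := LogEulerProduct.tendsto_sum_primesBelow
    (F := fun p : ℕ => Real.log (eSys(Fintype.card ι, f, s, p))) hsum
  have h2 : Tendsto (fun N : ℕ => Real.exp (∑ p ∈ primesBelow N,
      Real.log (eSys(Fintype.card ι, f, s, p)))) atTop
      (𝓝 (Real.exp (∑' p : Nat.Primes, Real.log (eSys(Fintype.card ι, f, s, p))))) :=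
    (Real.continuous_exp.tendsto _).comp h1
  have heq : (fun N : ℕ => ∏ p ∈ primesBelow N, eSys(Fintype.card ι, f, s, p)) =
      fun N : ℕ => Real.exp (∑ p ∈ primesBelow N, Real.log (eSys(Fintype.card ι, f, s, p))) := by
    funext N
    rw [Real.exp_sum]
    exact Finset.prod_congr rfl fun p hp =>
      (Real.exp_log (eulerFactorSys_pos hf (Nat.mem_primesBelow.mp hp).2 hs.le)).symm
  rw [heq]
  exact h2

/-- The Euler product of the real Dirichlet series `Σ_n μ(n)ω_f(n) n^{-s}`, `s > 1`: its `p`-factor is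
`1 − ω_f(p)p^{-s}` (`ω_f` is multiplicative; absolute convergence from `ω_f(p) ≤ Σ deg fᵢ` through
`lseriesSummable_of_isMultiplicative_of_prime_pow_le`). [folklore] -/
theorem tendsto_prod_primesBelow_moebiusRootCountSys {s : ℝ} (hs : 1 < s) :
    Tendsto (fun N : ℕ => ∏ p ∈ primesBelow N,
      (1 - (polyRootCountMod f p : ℝ) * (p : ℝ) ^ (-s))) atTop
      (𝓝 (∑' n : ℕ, (ArithmeticFunction.moebius n : ℝ) * (polyRootCountMod f n : ℝ) *
        (n : ℝ) ^ (-s))) := by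
  set F : ℤ[X] := ∏ i, f i with hF
  set g : ℕ → ℝ := fun n => (ArithmeticFunction.moebius n : ℝ) *
    (polyRootCountMod f n : ℝ) * (n : ℝ) ^ (-s) with hg
  have hω1 : polyRootCountMod f 1 = 1 := by
    rw [← polyRootCountMod_prod_single]; exact polyRootCountMod_single_one _
  have hg₁ : g 1 = 1 := by simp [hg, hω1]
  have hg₀ : g 0 = 0 := by simp [hg]
  have hmul : ∀ {m n : ℕ}, Nat.Coprime m n → g (m * n) = g m * g n := by
    intro m n hmn
    simp only [hg]
    rw [ArithmeticFunction.isMultiplicative_moebius.map_mul_of_coprime hmn,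
      polyRootCountModSys_mul_of_coprime f hmn, Nat.cast_mul, Nat.cast_mul, Int.cast_mul,
      Real.mul_rpow (Nat.cast_nonneg _) (Nat.cast_nonneg _)]
    ring
  -- absolute convergence through the complex `L`-series of `μρ_F`
  have hD : ∀ p : ℕ, p.Prime → (polyRootCountMod ![F] p : ℝ) ≤ ((∑ i, (f i).natDegree : ℕ) : ℝ) := by
    intro p hp
    rw [polyRootCountMod_prod_single]
    exact sys_rootCount_le hf hp
  have hpp : ∀ p : ℕ, p.Prime → ∀ j : ℕ, 1 ≤ j →
      ‖μρ[F] (p ^ j)‖ ≤ ((∑ i, (f i).natDegree : ℕ) : ℝ) * ((j : ℝ) + 1) ^ 0 := by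
    intro p hp j hj
    rw [pow_zero, mul_one]
    rcases eq_or_lt_of_le hj with rfl | hj2
    · rw [pow_one, moebiusRootCount_prime F hp, norm_neg, Complex.norm_natCast]
      exact hD p hp
    · rw [moebiusRootCount_prime_pow F hp hj2, norm_zero]
      positivity
  have hprimes : Summable fun p : Nat.Primes => ‖μρ[F] p‖ * (p : ℝ) ^ (-s) := by
    have h1 : Summable fun p : Nat.Primes =>
        ((∑ i, (f i).natDegree : ℕ) : ℝ) * ((p : ℕ) : ℝ) ^ (-s) :=
      ((Nat.Primes.summable_rpow).mpr (by linarith)).mul_left _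
    refine h1.of_nonneg_of_le (fun p => by positivity) fun p => ?_
    refine mul_le_mul_of_nonneg_right ?_ (by positivity)
    have := hpp p p.prop 1 le_rfl
    simpa using this
  obtain ⟨B, hL, -⟩ := lseriesSummable_of_isMultiplicative_of_prime_pow_le
    (isMultiplicative_moebiusRootCount F) (Nat.cast_nonneg _) (N := 0)
    (by linarith : (1 : ℝ) / 2 < s) hpp hprimes
  have hsum : Summable (fun n => ‖g n‖) := by
    refine hL.norm.congr fun n => ?_
    rw [LSeries.norm_term_eq]
    rcases eq_or_ne n 0 with rfl | hn
    · simp [hg]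
    · rw [if_neg hn, moebiusRootCount_apply, norm_mul, Complex.norm_intCast,
        Complex.norm_natCast, Complex.ofReal_re, polyRootCountMod_prod_single, hg]
      dsimp only
      rw [norm_mul, norm_mul, Real.norm_eq_abs, Real.norm_eq_abs, Real.norm_eq_abs,
        Nat.abs_cast, abs_of_nonneg (Real.rpow_nonneg (Nat.cast_nonneg _) _),
        Real.rpow_neg (Nat.cast_nonneg _), div_eq_mul_inv]
  have hE := EulerProduct.eulerProduct hg₁ hmul hsum hg₀
  have hloc : ∀ {p : ℕ}, p.Prime →
      ∑' e, g (p ^ e) = 1 - (polyRootCountMod f p : ℝ) * (p : ℝ) ^ (-s) := by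
    intro p hp
    rw [tsum_eq_sum (s := {0, 1}) ?_]
    · rw [Finset.sum_pair (by norm_num), pow_zero, pow_one, hg₁]
      simp only [hg]
      rw [ArithmeticFunction.moebius_apply_prime hp]
      push_cast
      ring
    · intro e he
      have he2 : 2 ≤ e := by
        simp only [Finset.mem_insert, Finset.mem_singleton] at he
        omega
      simp only [hg]
      rw [ArithmeticFunction.moebius_apply_prime_pow hp (by omega)]
      simp [show e ≠ 1 by omega]
  refine hE.congr' (Eventually.of_forall fun N => ?_)
  exact Finset.prod_congr rfl fun p hp => hloc (Nat.mem_primesBelow.mp hp).2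

/-- **`(Σ_n μ(n)ω_f(n) n^{-s})·(Σ_n n^{-s})^k → C(f)` as `s → 1⁺`** (real `s`): the Bateman–Horn
constant of a system is the Abelian limit `lim_{s→1⁺} ζ(s)^k ∏_p (1 − ω_f(p) p^{-s})` of its
absolutely convergent Euler products. [cite: BatemanHornMathComp1962, §2 eq. (2)] -/
theorem tendsto_moebiusRootCountSys_mul_zetaReal_pow :
    Tendsto (fun s : ℝ => (∑' n : ℕ, (ArithmeticFunction.moebius n : ℝ) *
        (polyRootCountMod f n : ℝ) * (n : ℝ) ^ (-s)) * (ζℝ(s)) ^ Fintype.card ι)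
      (𝓝[>] 1) (𝓝 (batemanHornConst f)) := by
  refine (tendsto_exp_tsum_log_eulerFactorSys hf).congr' ?_
  filter_upwards [self_mem_nhdsWithin] with s (hs : 1 < s)
  have h1 := tendsto_prod_primesBelow_eulerFactorSys hf hs
  have h2 := ((tendsto_prod_primesBelow_zetaReal hs).pow (Fintype.card ι)).mul
    (tendsto_prod_primesBelow_moebiusRootCountSys hf hs)
  have h3 : Tendsto (fun N : ℕ => ∏ p ∈ primesBelow N, eSys(Fintype.card ι, f, s, p)) atTop
      (𝓝 ((ζℝ(s)) ^ Fintype.card ι * ∑' n : ℕ, (ArithmeticFunction.moebius n : ℝ) *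
        (polyRootCountMod f n : ℝ) * (n : ℝ) ^ (-s))) := by
    refine h2.congr fun N => ?_
    rw [← Finset.prod_pow, ← Finset.prod_mul_distrib]
  exact (tendsto_nhds_unique h1 h3).trans (mul_comm _ _)

end System

end Literature.NumberTheory.LFunctions
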